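import Literature.MathematicalPhysics.QuantumFieldTheory.Balaban1983to89.B11Prop6ConcreteWitness
import Summits.QuantumFields.YangMills.Theorems.BalabanUVNodesN16Faces
import HarnessLib

/-!
# Route «BalabanUVNodes» (cluster K3 «SpineGivenEndpointR11», spine rates), Track-A DAG node N16 = NE3 — N16's LOCAL HALF IN THE SUP CURRENCY
# WITH THE RESPONSE BINDER R1^ϱ DISCHARGED AT THE OBJECTS BY [Balaban1985Variational] PROPOSITION 6 ON THE CONCRETE (115) CARRIERS (BY NAME)

Cell `pub-ymgap`, seat `pub-ymgap-dag-n16-d` (R134 ACCELERATION SEAT, strategy s3 = ALTERNATIVE CURRENCY; director-ym R134 row «`…-n16-d` s3 —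
R1^ϱ = [B11] Prop 6 p.295 CONCRETE (`prop6Printed_concrete`; ONE proof shared with N07 — files `--supports` both)»; HUMAN RULING D-0062; chair R424
venue).  `bears_on: R4∕N16`.  Filed `--supports stmt-QuantumFields-19676` (K3 `SpineGivenEndpointR11`); the N07 side of the share is n07-b's own filing
of the ONE proof (`Literature/…/B11Prop6Concrete.lean` p422035, `…/B11Prop6ConcreteWitness.lean` p422832, `--supports` N07's K1 item).

WHAT THIS FILE IS.  The pub-balaban NE3 «v4 re-cut» (census `pub-balaban-gaps/ne/NE3.md` §4 R8; kernel `T4FixedPointResponse` §8) reads NE3's LOCAL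
half — `T4EtaRateMin.LocalRate R C θ`: consecutive runs' local readings differ by `≤ C·θ^k` — from FOUR named binders: `hread` (R3-type: the reading is
Λr-Lipschitz in the response field + a pairing defect), **`hresp` (R1^ϱ: the response field is at most `Γ` times the PROPAGATED CONCRETE RESIDUAL
`ϱ = ‖𝔊(U₀)J(U₀)‖₍₁₁₅₎`, Γ = 2 — [Balaban1985Variational] Sect. E (116)–(121) ∕ Prop. 6, the fixed-point ∕ Lipschitz-response TYPE)**, `hosc` (OSC =
R2^ϱ: the residual has a geometric rate — NOT PRINTED, GAPS row NE3-R2, the wall of record) and `hpair` (pairing rate).  On the road OF RECORD N16 is read in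
the ENERGY currency from the N05- and N07-interfaces (`BalabanUVNodesN16.n16_of_inEdges`, `BalabanUVNodesN16ShapeKnit.ne3Shape_of_inEdges`); THIS file is
the ALTERNATIVE-CURRENCY twin in which the binder `hresp` is no longer a hypothesis: it is DISCHARGED, uniformly over a level-indexed family of
[Balaban1985Variational] Sect. E carriers AT OBJECTS with ONE threshold before the index, by n07-b's concrete Proposition 6
(`B11Prop6Concrete.r1rho_concrete_printed` ∕ `solA_spec_concrete` through `B11Prop6ConcreteWitness.norm_solA_zero_le_two_osc`) — the «share with n16» of
the ROSTER row n07 («Prop 6 p.295 = NE3's R1^ϱ verbatim»), consumed BY NAME and restating nothing.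

CONTENT (0 `def`, 0 `sorry`; bookkeeping over landed theorems BY NAME):
* §1 **`resp_le_two_osc_carrier`** — R1^ϱ ON ONE Sect. E CARRIER AT OBJECTS (`B11Prop6Concrete.SectEDatum`): under the carrier's own (14) at the
  printed parameters `(C₁B₃ε₁, C₁ε₁)`, the Prop-6 regime `2B₀C₁B₃ε₁ ≤ ε₄`, `4ε₄ ≤ a₃`, `16B₀C₄ε₄ ≤ 1` and the admissibility radius `C₁B₃ε₁ ≤ α`
  (p. 280), the tree's solution `𝒜 = solA 𝔊(U₀) 0 W(U₀) J(U₀) ε₄ 0` of Eq. (111) with EXACT constraints (`𝔄 = H₁B = 0`, p. 299 «B = 0») obeys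
  `‖𝒜‖₍₁₁₅₎ ≤ 2·‖𝔊(U₀)J(U₀)‖₍₁₁₅₎`; **`resp_le_two_osc_family`** — the same for a LEVEL-INDEXED family of carriers (lattice `k` = spacing `L^{-k}`),
  a data set `dom` and a background-of-record assignment `bg k V` satisfying (14): LITERALLY the binder shape `hresp` of
  `T4FixedPointResponse.localRate_of_oneStep` with `Γ = 2`, `nrm k V := ‖𝒜 at bg k V‖₍₁₁₅₎`, `osc k V := ‖𝔊(U₀)J(U₀)‖₍₁₁₅₎ at U₀ = bg k V`.
* §2 **`localRate_of_oneStep_prop6Concrete`** — NE3's local half `LocalRate R (Λr·2·ρ₁ + ρ₂) θ` from `hread` ∧ `hosc` ∧ `hpair` ONLY (R1^ϱ gone).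
* §3 **`ne3Shape_of_leafH3sup_oneStep_prop6Concrete`** — `d = 4`: N16's DECL `T4EtaRateMin.NE3Shape (minActReadings 4 (sfClass 4 L N ε) L N dom loc) C θ`
  from N07's interface `LeafH3sup 4 L N ε b c dom` ALONE for the ACTION half (face (A), `BalabanUVNodesN16Faces.actionRate_of_leafH3sup_four`, numeric regime
  verbatim) and §2's three binders for the LOCAL half, `L⁻² ≤ θ < 1` — the alternative-currency twin of `ne3Shape_of_inEdges` with the N05-interface
  ([Balaban1985RegularSpaces] Thm 2 + (1.37) at the pair) REPLACED by OSC ∧ reading ∧ pairing and R1^ϱ discharged.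
* §4 **`resp_family_binders_inhabited`** — VACUITY GUARD: the binders of §1 ((14) at the printed parameters on every level, at an admissible background) are
  jointly satisfiable (flat datum of `B11Prop6ConcreteWitness.prop6_binders_satisfiable` on every lattice), so §1–§2 are no ex falso.
* §5 **`jcur_one_eq_zero`** (the flat background's current (27)–(28) VANISHES: `Jcur 1 = 0`, so NE3's `ϱ` is `0` there for every letter `𝔊`) and
  **`altCurrency_binders_inhabited_flatStratum`** — VACUITY GUARD AT `d = 4`: at a regime point of §3 (`BalabanUVNodesN16Shape.shapeRegime_exists`), on the
  flat stratum `FS_N ∋ 1` of the genuine class, the data class, N07's interface (g0's `leafH3sup_flatStratum`), `θ = L⁻² < 1`, the Prop-6 regime at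
  `B₀ = C₄ = a₃ = α = C₁ = 1`, `B₃ = 4L`, `ε₁ᴮ¹¹ = (128L)⁻¹`, `ε₄ = 1∕16`, a Sect. E family with (14) at every datum, and OSC with `ρ₁ = 0` hold JOINTLY —
  so §3 applies there and none of its binders is vacuous.

HONEST FRAMING.  Junction ∕ bookkeeping by name; nothing of Bałaban's is asserted.  (i) The identification «`nrm k V` = the (115)-size of the response field of
`U_k(V)` written around the averaged finer minimiser `W_k(V) = Q₁U_{k+1}(V)`» is [Balaban1985Variational] Props 2∕5∕7 at objects + the nesting identity
(`T4FixedPointResponse` §6–§7) and rides INSIDE the binder `hread` — displayed, not claimed (n07-b's caveat on `norm_solA_zero_le_two_osc`, verbatim).  (ii) OSC is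
NOT PRINTED (census R8: the sup-currency road is walled at OSC; this file does not touch the wall, it removes the other binder).  (iii) The in-edge letters
[Balaban1985BackgroundPropagators] Thms 3.12∕3.13 and [Balaban1985Variational] Prop. 4 are the Sect. E datum's displayed FIELDS (`norm_G`, `norm_H₁`, `prop4`; N06∕N07
content), exactly as in `B11Prop6Concrete`.  (iv) **N16 ∕ NE3 is NOT discharged** (count unchanged); one finite four-torus at fixed ε — NOT ℝ⁴, NOT infinite
volume, NOT OS, NOT a mass gap, NOT Clay.
-/

set_option autoImplicit false

open scoped BigOperators Matrix Matrix.Norms.L2Operator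
open NormedSpace

namespace Summit.QuantumFields.YangMills.BalabanUVNodes.N16

open Literature.MathematicalPhysics.QuantumFieldTheory.Balaban1983to89
open B11Prop6Concrete (SectEDatum Rest)
open B11Prop6ConcreteWitness (norm_solA_zero_le_two_osc prop6_binders_satisfiable)
open B11Eq174Chart (solA)
open B11Eq98CurrentSlot (Jcur)
open T4EtaRateMin (Readings ActionRate LocalRate NE3Shape)
open T4FixedPointResponse (OneStepCorrectionRate localRate_of_oneStep')

noncomputable section

/-! ## §1 R1^ϱ — the response binder `hresp` (Γ = 2) on the Sect. E carriers at objects, by [B11] Proposition 6 concrete -/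

section Carrier

variable {𝔸 : Type} [NormedRing 𝔸] [NormedAlgebra ℂ 𝔸] [StarRing 𝔸] [FiniteDimensional ℂ 𝔸] [NormedStarGroup 𝔸] [StarModule ℂ 𝔸]
variable {d : ℕ} {L : ℝ} [Fact (0 < L)] {B₀ C₄ a₃ B₃ α : ℝ}

/-- **R1^ϱ ON ONE Sect. E CARRIER AT OBJECTS** ([Balaban1985Variational] Prop. 6 p. 295 with (121), read as NE3's response binder; p. 299 «B = 0»): for a
Sect. E datum `D` over the periodic lattice (`B11Prop6Concrete.SectEDatum`, remaining fields `R`), positive printed constants, `d ≥ 1`, the Prop-6 regime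
`2B₀C₁B₃ε₁ ≤ ε₄`, `4ε₄ ≤ a₃`, `16B₀C₄ε₄ ≤ 1` and the admissibility radius `C₁B₃ε₁ ≤ α`, at every `(V, U₀)` in the carrier's (14) with parameters
`(C₁B₃ε₁, C₁ε₁)` the tree's solution `𝒜 := solA (D.G U₀) 0 (D.W U₀) (Jcur U₀) ε₄ 0` of Eq. (111) with exact constraints satisfies
`‖𝒜‖₍₁₁₅₎ ≤ 2·‖(D.G U₀)(Jcur U₀)‖₍₁₁₅₎` — carrier transport of `B11Prop6ConcreteWitness.norm_solA_zero_le_two_osc` (admissibility by `SectEDatum.adm_of`,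
the current clause of (2) by `SectEDatum.sat14_cur_of`, unitarity by `bg_unitary`, the letters' bounds by the datum's fields `norm_G` ∕ `prop4`).
[cite: Balaban1985Variational, Prop. 6 p.295, (121) p.295, (14) p.280] -/
theorem resp_le_two_osc_carrier {Pd : Fin d → ℕ} {η : ℝ} [Fact (0 < η)] {β : Type} [Fintype β]
    (D : SectEDatum d Pd 𝔸 L η β B₀ C₄ a₃ B₃ α) (R : Rest D) (hd : 1 ≤ d) (hB₀ : 0 < B₀) (hC₄ : 0 < C₄)
    {C₁ ε₁ ε₄ : ℝ} (hC₁ : 0 < C₁) (hB₃ : 0 < B₃) (hε₁ : 0 < ε₁)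
    (h1 : 2 * B₀ * C₁ * B₃ * ε₁ ≤ ε₄) (h2 : 4 * ε₄ ≤ a₃) (h3 : 16 * B₀ * C₄ * ε₄ ≤ 1) (hα : C₁ * B₃ * ε₁ ≤ α)
    {V : D.Bdry} {c : D.Cfg} (h14 : (D.toLGData R C₁).Sat14 (C₁ * B₃ * ε₁) (C₁ * ε₁) V c) :
    ‖solA (D.G c) 0 (D.W c) (Jcur (D.bg c)) ε₄ 0‖ ≤ 2 * ‖D.G c (Jcur (D.bg c))‖ := by
  have hL : (0 : ℝ) < L := Fact.out
  have hd' : (0 : ℝ) < (d : ℝ) := by exact_mod_cast hd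
  have hdL : (0 : ℝ) < (d : ℝ) * L := mul_pos hd' hL
  have hc : D.Adm c := D.adm_of R C₁ h14 hα
  exact norm_solA_zero_le_two_osc (D.bg c) (D.norm_G c hc) (D.prop4 c hc).quadAnalytic hB₀ hC₄ hC₁ hB₃ hε₁ hdL
    D.dL_le h1 h2 h3 (D.bg_unitary c) (D.sat14_cur_of R C₁ h14)

/-- **R1^ϱ FOR A LEVEL-INDEXED FAMILY OF Sect. E CARRIERS — LITERALLY THE BINDER `hresp` OF `T4FixedPointResponse.localRate_of_oneStep` WITH `Γ = 2`.**
For lattices `Pdf k` at spacings `ηf k` (`k` = the run ∕ level index), Sect. E data `D k` with remaining fields `R k` (d, L, 𝔸 and the printed constants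
`B₀, C₄, a₃, B₃`, the admissibility threshold `α` FIXED BEFORE the index — the uniformity is the in-edges' content, displayed in the data's fields), ONE
regime `2B₀C₁B₃ε₁ ≤ ε₄`, `4ε₄ ≤ a₃`, `16B₀C₄ε₄ ≤ 1`, `C₁B₃ε₁ ≤ α`, a data set `dom` and, per level and datum, a boundary datum `bd k V` and a
BACKGROUND OF RECORD `bg k V` (intended: the averaged finer minimiser `W_k(V)`, in the class (14) with `B = 0` — a PARAMETER here) satisfying the carrier's
(14): for all `k` and all `V ∈ dom`, `nrm k V ≤ 2·osc k V` with `nrm k V := ‖solA 𝔊 0 W J ε₄ 0‖₍₁₁₅₎` at `bg k V` and `osc k V := ‖𝔊(U₀)J(U₀)‖₍₁₁₅₎`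
there (NE3's `ϱ`). [cite: Balaban1985Variational, Prop. 6 p.295, (121) p.295, p.299] -/
theorem resp_le_two_osc_family {Pdf : ℕ → Fin d → ℕ} {ηf : ℕ → ℝ} [∀ k, Fact (0 < ηf k)] {βf : ℕ → Type}
    [∀ k, Fintype (βf k)] (D : ∀ k, SectEDatum d (Pdf k) 𝔸 L (ηf k) (βf k) B₀ C₄ a₃ B₃ α) (R : ∀ k, Rest (D k))
    (hd : 1 ≤ d) (hB₀ : 0 < B₀) (hC₄ : 0 < C₄) {C₁ ε₁ ε₄ : ℝ} (hC₁ : 0 < C₁) (hB₃ : 0 < B₃) (hε₁ : 0 < ε₁)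
    (h1 : 2 * B₀ * C₁ * B₃ * ε₁ ≤ ε₄) (h2 : 4 * ε₄ ≤ a₃) (h3 : 16 * B₀ * C₄ * ε₄ ≤ 1) (hα : C₁ * B₃ * ε₁ ≤ α)
    {ι : Type*} (dom : Set ι) (bd : ∀ k, ι → (D k).Bdry) (bg : ∀ k, ι → (D k).Cfg)
    (h14 : ∀ k, ∀ V ∈ dom, ((D k).toLGData (R k) C₁).Sat14 (C₁ * B₃ * ε₁) (C₁ * ε₁) (bd k V) (bg k V)) :
    ∀ k, ∀ V ∈ dom,
      ‖solA ((D k).G (bg k V)) 0 ((D k).W (bg k V)) (Jcur ((D k).bg (bg k V))) ε₄ 0‖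
        ≤ 2 * ‖(D k).G (bg k V) (Jcur ((D k).bg (bg k V)))‖ :=
  fun k V hV => resp_le_two_osc_carrier (D k) (R k) hd hB₀ hC₄ hC₁ hB₃ hε₁ h1 h2 h3 hα (h14 k V hV)

/-! ## §2 NE3's local half in the sup currency: `LocalRate` from `hread` ∧ `hosc` ∧ `hpair`, R1^ϱ discharged -/

/-- **NE3's LOCAL HALF (SUP CURRENCY, v4 re-cut) WITH THE RESPONSE BINDER DISCHARGED BY [B11] PROPOSITION 6 CONCRETE.**  In the setting of
`resp_le_two_osc_family` (family `D k`, `R k`, regime, backgrounds of record `bg k V` with (14) for `V ∈ Rd.dom`), for readings `Rd : Readings ι X`: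
IF `hread` (the local reading of run `k+1` versus run `k` is `Λr`-Lipschitz in the response field `nrm k V := ‖solA 𝔊 0 W J ε₄ 0‖₍₁₁₅₎` at `bg k V`, plus
a pairing defect `pair k V` — R3-type; the identification of NE3's response field with this Prop-6 solution, [Balaban1985Variational] Props 2∕5∕7 at objects
+ nesting, rides inside this binder), `hosc` (OSC: `osc k V := ‖𝔊(U₀)J(U₀)‖₍₁₁₅₎ ≤ ρ₁θ^k` — `T4FixedPointResponse.OneStepCorrectionRate`, NOT PRINTED, the wall)
and `hpair` (`pair k V ≤ ρ₂θ^k`), THEN `LocalRate Rd (Λr·2·ρ₁ + ρ₂) θ`.  `T4FixedPointResponse.localRate_of_oneStep'` with `hresp` := §1.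
[cite: Balaban1985Variational, Prop. 6 p.295, (116)–(121) p.295] -/
theorem localRate_of_oneStep_prop6Concrete {Pdf : ℕ → Fin d → ℕ} {ηf : ℕ → ℝ} [∀ k, Fact (0 < ηf k)] {βf : ℕ → Type}
    [∀ k, Fintype (βf k)] (D : ∀ k, SectEDatum d (Pdf k) 𝔸 L (ηf k) (βf k) B₀ C₄ a₃ B₃ α) (R : ∀ k, Rest (D k))
    (hd : 1 ≤ d) (hB₀ : 0 < B₀) (hC₄ : 0 < C₄) {C₁ ε₁ ε₄ : ℝ} (hC₁ : 0 < C₁) (hB₃ : 0 < B₃) (hε₁ : 0 < ε₁)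
    (h1 : 2 * B₀ * C₁ * B₃ * ε₁ ≤ ε₄) (h2 : 4 * ε₄ ≤ a₃) (h3 : 16 * B₀ * C₄ * ε₄ ≤ 1) (hα : C₁ * B₃ * ε₁ ≤ α)
    {ι X : Type*} (Rd : Readings ι X) (bd : ∀ k, ι → (D k).Bdry) (bg : ∀ k, ι → (D k).Cfg)
    (h14 : ∀ k, ∀ V ∈ Rd.dom, ((D k).toLGData (R k) C₁).Sat14 (C₁ * B₃ * ε₁) (C₁ * ε₁) (bd k V) (bg k V))
    {Λr ρ₁ ρ₂ θ : ℝ} (hΛr : 0 ≤ Λr) (pair : ℕ → ι → ℝ)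
    (hread : ∀ k : ℕ, ∀ V ∈ Rd.dom, ∀ x : X,
      |Rd.loc (k + 1) V x - Rd.loc k V x|
        ≤ Λr * ‖solA ((D k).G (bg k V)) 0 ((D k).W (bg k V)) (Jcur ((D k).bg (bg k V))) ε₄ 0‖ + pair k V)
    (hosc : OneStepCorrectionRate Rd.dom (fun k V => ‖(D k).G (bg k V) (Jcur ((D k).bg (bg k V)))‖) ρ₁ θ)
    (hpair : OneStepCorrectionRate Rd.dom pair ρ₂ θ) :
    LocalRate Rd (Λr * 2 * ρ₁ + ρ₂) θ :=
  localRate_of_oneStep' (R := Rd)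
    (fun k V => ‖solA ((D k).G (bg k V)) 0 ((D k).W (bg k V)) (Jcur ((D k).bg (bg k V))) ε₄ 0‖)
    (fun k V => ‖(D k).G (bg k V) (Jcur ((D k).bg (bg k V)))‖) pair (by norm_num) hΛr hread
    (resp_le_two_osc_family D R hd hB₀ hC₄ hC₁ hB₃ hε₁ h1 h2 h3 hα Rd.dom bd bg h14) hosc hpair

end Carrier

/-! ## §3 N16's DECL `NE3Shape` at `d = 4` in the alternative currency: N07-interface (action half) ∧ OSC ∧ reading ∧ pairing (local half) -/

section DeclFour

open B7Prop1Explicit B7Prop2Explicit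
open T4AveragingDeficitNonAbelian (wallConstNA wallConstNA_nonneg)
open Summit.QuantumFields.BalabanUV.T4Continuum
open MinimalActionRate (sfClass minActReadings)
open MinimalActionRefine (gradConst gradConst_nonneg)
open NE3.LeafIndexSockets (LeafH3sup)
open NE3LocalCrudeEnd (actionRate_mono_rate)

variable {n : Type*} [Fintype n] [DecidableEq n]
variable {𝔸 : Type} [NormedRing 𝔸] [NormedAlgebra ℂ 𝔸] [StarRing 𝔸] [FiniteDimensional ℂ 𝔸] [NormedStarGroup 𝔸] [StarModule ℂ 𝔸]
variable {B₀ C₄ a₃ B₃ α : ℝ}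

/-- **N16's DECL IN THE ALTERNATIVE CURRENCY** (`d = 4`; `L ≥ 2`, `N ≥ 1`).  ACTION half: N07's interface `LeafH3sup 4 L N ε b c dom`
([Balaban1985Variational] Thm 1 (8)+(10) TYPE) under the numeric regime of `BalabanUVNodesN16Faces.actionRate_of_leafH3sup_four` VERBATIM (radii
`0 ≤ b, c ≤ t`, `2^91·L^17·t ≤ 1`, class radius `2^76·L^12·t ≤ ε`, compactness `16·C₀(4)·ε ≤ 3`, `1024·5·8·L²·ε ≤ 1`, data class `dom ⊆ sfClass 4 L N ε₁ 0`,
`ε₁ ≤ 1∕4`, `ε₁ ≤ b`, `4ε₁ ≤ c`) gives `ActionRate … (wallConstNA(4,L)(gradConst 4 1 + 1)∕L²) (L⁻²)` for EVERY local reading `loc`.  LOCAL half: the three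
sup-currency binders of `localRate_of_oneStep_prop6Concrete` for the SAME `loc` over a level-indexed family of Sect. E carriers at objects (backgrounds of record
`bg k V` in (14), OSC `osc ≤ ρ₁θ^k` NOT PRINTED, pairing `≤ ρ₂θ^k`, `0 ≤ ρ₁, ρ₂`), with R1^ϱ DISCHARGED by [B11] Prop. 6 concrete; `L⁻² ≤ θ < 1`.  CONCLUSION:
`NE3Shape (minActReadings 4 (sfClass 4 L N ε) L N dom loc) (max C_A (Λr·2·ρ₁ + ρ₂)) θ` — the DECL of record of row N16 on Bałaban's minimiser readings.  The
alternative-currency twin of `BalabanUVNodesN16ShapeKnit.ne3Shape_of_inEdges` (there: N05 ∧ N07 interfaces, energy currency); N16 is NOT discharged by either.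
[cite: Balaban1985Variational, Thm 1 p.279, Prop. 6 p.295] -/
theorem ne3Shape_of_leafH3sup_oneStep_prop6Concrete [Nonempty n] {L N : ℕ} (hL : 2 ≤ L) (hN : 1 ≤ N) {ε ε₁ b c t : ℝ}
    (hb : 0 ≤ b) (hc : 0 ≤ c) (hbt : b ≤ t) (hct : c ≤ t)
    (hsmall : (2 : ℝ) ^ 91 * (L : ℝ) ^ 17 * t ≤ 1) (hεt : (2 : ℝ) ^ 76 * (L : ℝ) ^ 12 * t ≤ ε)
    (hε1 : 16 * C0 4 * ε ≤ 3) (hε2 : 1024 * (4 + 1) * (4 + 4) * (L : ℝ) ^ 2 * ε ≤ 1)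
    (hε₁ : ε₁ ≤ 1 / 4) (hε₁b : ε₁ ≤ b) (hε₁c : 4 * ε₁ ≤ c)
    {dom : Set (Site 4 → Fin 4 → (Matrix n n ℂ)ˣ)} (hdom : dom ⊆ sfClass 4 L N ε₁ 0) (h3 : LeafH3sup 4 L N ε b c dom)
    {X : Type*} (loc : ℕ → (Site 4 → Fin 4 → (Matrix n n ℂ)ˣ) → X → ℝ)
    -- the Sect. E carriers at objects, one per level `k` (the torus of run `k`: `N·L^k` sites per direction, block factor `L`,
    -- spacing letter `ηf k`, intended `L^{-k}`), and the backgrounds of record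
    [Fact (0 < (L : ℝ))] {ηf : ℕ → ℝ} [∀ k, Fact (0 < ηf k)] {βf : ℕ → Type} [∀ k, Fintype (βf k)]
    (D : ∀ k, SectEDatum 4 (fun _ : Fin 4 => N * L ^ k) 𝔸 (L : ℝ) (ηf k) (βf k) B₀ C₄ a₃ B₃ α)
    (R : ∀ k, Rest (D k))
    (hB₀ : 0 < B₀) (hC₄ : 0 < C₄) {C₁ e₁ ε₄ : ℝ} (hC₁ : 0 < C₁) (hB₃ : 0 < B₃) (he₁ : 0 < e₁)
    (h1 : 2 * B₀ * C₁ * B₃ * e₁ ≤ ε₄) (h2 : 4 * ε₄ ≤ a₃) (h3' : 16 * B₀ * C₄ * ε₄ ≤ 1) (hα : C₁ * B₃ * e₁ ≤ α)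
    (bd : ∀ k, (Site 4 → Fin 4 → (Matrix n n ℂ)ˣ) → (D k).Bdry) (bg : ∀ k, (Site 4 → Fin 4 → (Matrix n n ℂ)ˣ) → (D k).Cfg)
    (h14 : ∀ k, ∀ V ∈ dom, ((D k).toLGData (R k) C₁).Sat14 (C₁ * B₃ * e₁) (C₁ * e₁) (bd k V) (bg k V))
    -- the three remaining sup-currency binders and the rate
    {Λr ρ₁ ρ₂ θ : ℝ} (hΛr : 0 ≤ Λr) (hρ₁ : 0 ≤ ρ₁) (hρ₂ : 0 ≤ ρ₂) (hθ : ((L : ℝ) ^ 2)⁻¹ ≤ θ) (hθ1 : θ < 1)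
    (pair : ℕ → (Site 4 → Fin 4 → (Matrix n n ℂ)ˣ) → ℝ)
    (hread : ∀ k : ℕ, ∀ V ∈ dom, ∀ x : X,
      |loc (k + 1) V x - loc k V x|
        ≤ Λr * ‖solA ((D k).G (bg k V)) 0 ((D k).W (bg k V)) (Jcur ((D k).bg (bg k V))) ε₄ 0‖ + pair k V)
    (hosc : OneStepCorrectionRate dom (fun k V => ‖(D k).G (bg k V) (Jcur ((D k).bg (bg k V)))‖) ρ₁ θ)
    (hpair : OneStepCorrectionRate dom pair ρ₂ θ) :
    NE3Shape (minActReadings 4 (sfClass 4 L N ε) L N dom loc)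
      (max (wallConstNA 4 L * (gradConst 4 1 + 1) / (L : ℝ) ^ 2) (Λr * 2 * ρ₁ + ρ₂)) θ := by
  -- the action half from N07's interface alone (face (A)), rate `L⁻²`
  have hA := actionRate_of_leafH3sup_four hL hN hb hc hbt hct hsmall hεt hε1 hε2 hε₁ hε₁b hε₁c hdom h3 loc
  have hCA : 0 ≤ wallConstNA 4 L * (gradConst 4 1 + 1) / (L : ℝ) ^ 2 := by
    have := wallConstNA_nonneg (d := 4) L
    have := gradConst_nonneg (d := 4) (1 : ℝ)
    positivity
  have hθ0' : (0 : ℝ) ≤ ((L : ℝ) ^ 2)⁻¹ := by positivity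
  have hθ0 : 0 ≤ θ := hθ0'.trans hθ
  -- the local half in the sup currency, R1^ϱ discharged (§2)
  have hLoc : LocalRate (minActReadings 4 (sfClass 4 L N ε) L N dom loc) (Λr * 2 * ρ₁ + ρ₂) θ :=
    localRate_of_oneStep_prop6Concrete D R (by norm_num) hB₀ hC₄ hC₁ hB₃ he₁ h1 h2 h3' hα
      (minActReadings 4 (sfClass 4 L N ε) L N dom loc) bd bg h14 hΛr pair hread hosc hpair
  have hK : 0 ≤ Λr * 2 * ρ₁ + ρ₂ := by positivity
  exact ⟨hθ0, hθ1, actionRate_mono_rate hA (le_max_left _ _) hCA hθ0' hθ,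
    hLoc.mono (le_max_right _ _) hθ0 le_rfl hK⟩

end DeclFour

/-! ## §4 VACUITY GUARD: the binders of §1 are jointly satisfiable on every level -/

section Vacuity

variable {𝔸 : Type} [NormedRing 𝔸] [NormedAlgebra ℂ 𝔸] [StarRing 𝔸]
variable {d : ℕ} {L : ℝ} [Fact (0 < L)] {B₀ C₄ a₃ B₃ α : ℝ}

/-- **THE BINDERS OF §1 ARE INHABITED ON EVERY LEVEL** (flat stratum; [Balaban1985Variational] (2) p. 278 contains `U₀ ≡ 1` at every radius): for
`0 ≤ B₀`, `0 ≤ C₄`, `0 < dL ≤ B₃` and any lattices `Pdf k`, spacings `ηf k`, index types `βf k`, there are Sect. E data `D k`, remaining fields `R k`,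
boundary data `bd k V` and ADMISSIBLE backgrounds of record `bg k V` (the flat background, `(D k).bg (bg k V) = 1`) such that the carrier's (14) holds at the
printed parameters `(C₁B₃ε₁, C₁ε₁)` on every level for EVERY `C₁, ε₁ > 0` and every datum — `B11Prop6ConcreteWitness.prop6_binders_satisfiable` level by
level.  So `resp_le_two_osc_family` and `localRate_of_oneStep_prop6Concrete` quantify over a non-empty set of data. [cite: Balaban1985Variational, (2) p.278, (14) p.280] -/
theorem resp_family_binders_inhabited (Pdf : ℕ → Fin d → ℕ) (ηf : ℕ → ℝ) [∀ k, Fact (0 < ηf k)] (βf : ℕ → Type)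
    [∀ k, Fintype (βf k)] (hB₀ : 0 ≤ B₀) (hC₄ : 0 ≤ C₄) (hdL : 0 < (d : ℝ) * L) (hdLB₃ : (d : ℝ) * L ≤ B₃)
    (hB₃ : 0 < B₃) {ι : Type*} (dom : Set ι) :
    ∃ (D : ∀ k, SectEDatum d (Pdf k) 𝔸 L (ηf k) (βf k) B₀ C₄ a₃ B₃ α) (R : ∀ k, Rest (D k))
      (bd : ∀ k, ι → (D k).Bdry) (bg : ∀ k, ι → (D k).Cfg),
      (∀ k V, (D k).Adm (bg k V) ∧ (D k).bg (bg k V) = 1) ∧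
      ∀ C₁ ε₁ : ℝ, 0 < C₁ → 0 < ε₁ →
        ∀ k, ∀ V ∈ dom, ((D k).toLGData (R k) C₁).Sat14 (C₁ * B₃ * ε₁) (C₁ * ε₁) (bd k V) (bg k V) := by
  have h : ∀ k : ℕ, ∃ (D : SectEDatum d (Pdf k) 𝔸 L (ηf k) (βf k) B₀ C₄ a₃ B₃ α) (R : Rest D) (V : D.Bdry) (c : D.Cfg),
      D.Adm c ∧ D.bg c = 1 ∧
        ∀ C₁ ε₁ : ℝ, 0 < C₁ → 0 < ε₁ → 0 < B₃ → (D.toLGData R C₁).Sat14 (C₁ * B₃ * ε₁) (C₁ * ε₁) V c :=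
    fun k => prop6_binders_satisfiable (𝔸 := 𝔸) (d := d) (Pd := Pdf k) (L := L) (η := ηf k) (β := βf k)
      hB₀ hC₄ hdL hdLB₃ (fun _ => 0) (fun _ => 0)
  choose D R V c hAdm hbg h14 using h
  exact ⟨D, R, fun k _ => V k, fun k _ => c k, fun k _ => ⟨hAdm k, hbg k⟩,
    fun C₁ ε₁ hC₁ hε₁ k _ _ => h14 k C₁ ε₁ hC₁ hε₁ hB₃⟩

end Vacuity

/-! ## §5 VACUITY GUARD AT `d = 4`: every binder of §3 holds jointly on the flat stratum (the flat background's current VANISHES) -/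

section VacuityFour

open B7Prop1Explicit B7Prop2Explicit
open T4AveragingDeficitWall hiding Site Plane Plaq Bond
open T4AveragingDeficitWallBoundary (IsPeriodicCfg)
open B11Eq90V0primeCurrent (Tsh Ucur)
open B9SectCLatticeCarrier (Bond)
open Summit.QuantumFields.BalabanUV.T4Continuum
open MinimalActionRate (sfClass)
open MinimalActionWitness (flatCfg)
open NE3EnergyShapes (IsUnitarySite)
open NE3.LeafIndexSockets (LeafH3sup)
open NE7EtaBackgroundFlatStratum (flatCfg_mem_flatStratum)

variable {𝔸 : Type} [NormedRing 𝔸] [NormedAlgebra ℂ 𝔸] [StarRing 𝔸]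

omit [StarRing 𝔸] in
/-- **THE CURRENT OF THE FLAT BACKGROUND VANISHES**: `J(1) = D^{η*}(η⁻² Im ∂1) = 0` read in the `|·|₍₋₃₎`-carrier (`B11Eq98CurrentSlot.Jcur 1 = 0`;
[Balaban1985Variational] (27)–(28) p. 282 at `U₀ ≡ 1`: the plaquette variables are `1`, `Im 1 = 0`) — so at the flat background NE3's residual
`ϱ = ‖𝔊(U₀)J(U₀)‖₍₁₁₅₎` is `0` for EVERY letter `𝔊`, and the OSC binder holds there with `ρ₁ = 0`. [cite: Balaban1985Variational, (27)–(28) p.282] -/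
theorem jcur_one_eq_zero {d : ℕ} {Pd : Fin d → ℕ} {L η : ℝ} [Fact (0 < L)] [Fact (0 < η)] {lev₀ : Bond d Pd → ℕ} :
    Jcur (L := L) (η := η) (lev₀ := lev₀) (1 : Bond d Pd → 𝔸ˣ) = 0 := by
  have h0 : (fun b : Bond d Pd => B9Eq39Adjoint.J Tsh (Ucur (1 : Bond d Pd → 𝔸ˣ)) η b.2 b.1) = 0 := by
    funext b
    simp [B9Eq39Adjoint.J, B9Eq39Adjoint.divPη, B9Eq39Adjoint.divP, B9Eq39Adjoint.covDstar, B9Eq39Adjoint.R,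
      B9Eq39Adjoint.plaqU, Ucur, B9Eq37Insertion.imC]
  unfold Jcur
  rw [h0]
  rfl

variable {n : Type*} [Fintype n] [DecidableEq n]

/-- **NO BINDER OF §3 IS VACUOUS** (`L ≥ 2`, `N ≥ 1`, any radius `r > 0`; any fibre algebra `𝔸`, spacing letters `ηf`, constraint-bond indices `βf`):
there is a regime point `(ε, t, ε₁)` of §3 (`b = c = t`; `BalabanUVNodesN16Shape.shapeRegime_exists`) at which, on the FLAT STRATUM
`FS_N = {v N-periodic | ∃ w unitary, v = 1^{w}}` of the genuine class `sfClass 4 L N ε` (torons included): the data class holds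
(`flatStratum_subset_sfClass_zero`), the datum set is NON-EMPTY (`1 ∈ FS_N`), N07's interface holds (g0's `leafH3sup_flatStratum`), the rate
`θ = L⁻²` is `< 1`, AND the Sect. E side is inhabited on every level with the printed constants `B₀ = C₄ = a₃ = α = C₁ = 1`, `B₃ = 4L`,
`ε₁ᴮ¹¹ = (128L)⁻¹`, `ε₄ = 1∕16` meeting the Prop-6 regime (`2B₀C₁B₃ε₁ ≤ ε₄`, `4ε₄ ≤ a₃`, `16B₀C₄ε₄ ≤ 1`, `C₁B₃ε₁ ≤ α`): data `D k`, `R k`,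
boundary data and FLAT backgrounds of record with the carrier's (14) at EVERY datum of `FS_N` (§4), at which the OSC binder holds with
`ρ₁ = 0` because the flat background's current vanishes (`jcur_one_eq_zero`) — `hread`∕`hpair` then hold for the zero reading with
`Λr = ρ₂ = 0`, so `ne3Shape_of_leafH3sup_oneStep_prop6Concrete` APPLIES on `FS_N` and its hypothesis set is jointly satisfiable on ONE class
family.  (The informative readings are the (D)∕(F) readings of the minimisers; this theorem certifies satisfiability only.) [folklore] -/
theorem altCurrency_binders_inhabited_flatStratum [Nonempty n] {L N : ℕ} (hL : 2 ≤ L) (hN : 1 ≤ N) {r : ℝ} (hr : 0 < r)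
    [Fact (0 < (L : ℝ))] (ηf : ℕ → ℝ) [∀ k, Fact (0 < ηf k)] (βf : ℕ → Type) [∀ k, Fintype (βf k)] :
    ∃ ε t ε₁ : ℝ, 0 < ε ∧ ε ≤ r ∧ 0 < t ∧ 0 < ε₁ ∧
      (2 : ℝ) ^ 91 * (L : ℝ) ^ 17 * t ≤ 1 ∧ (2 : ℝ) ^ 76 * (L : ℝ) ^ 12 * t ≤ ε ∧
      16 * C0 4 * ε ≤ 3 ∧ 1024 * (4 + 1) * (4 + 4) * (L : ℝ) ^ 2 * ε ≤ 1 ∧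
      ε₁ ≤ 1 / 4 ∧ ε₁ ≤ t ∧ 4 * ε₁ ≤ t ∧
      {v : Site 4 → Fin 4 → (Matrix n n ℂ)ˣ | IsPeriodicCfg v (N : ℤ) ∧ ∃ w : Site 4 → (Matrix n n ℂ)ˣ,
          IsUnitarySite w ∧ v = gaugeAct w flatCfg} ⊆ sfClass 4 L N ε₁ 0 ∧
      (flatCfg : Site 4 → Fin 4 → (Matrix n n ℂ)ˣ) ∈ {v : Site 4 → Fin 4 → (Matrix n n ℂ)ˣ | IsPeriodicCfg v (N : ℤ) ∧
          ∃ w : Site 4 → (Matrix n n ℂ)ˣ, IsUnitarySite w ∧ v = gaugeAct w flatCfg} ∧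
      LeafH3sup 4 L N ε t t
        {v : Site 4 → Fin 4 → (Matrix n n ℂ)ˣ | IsPeriodicCfg v (N : ℤ) ∧ ∃ w : Site 4 → (Matrix n n ℂ)ˣ,
          IsUnitarySite w ∧ v = gaugeAct w flatCfg} ∧
      ((L : ℝ) ^ 2)⁻¹ < 1 ∧
      (2 * 1 * 1 * (4 * (L : ℝ)) * (128 * (L : ℝ))⁻¹ ≤ 1 / 16 ∧ 4 * (1 / 16 : ℝ) ≤ 1 ∧ 16 * 1 * 1 * (1 / 16 : ℝ) ≤ 1 ∧
        1 * (4 * (L : ℝ)) * (128 * (L : ℝ))⁻¹ ≤ 1) ∧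
      ∃ (D : ∀ k, SectEDatum 4 (fun _ : Fin 4 => N * L ^ k) 𝔸 (L : ℝ) (ηf k) (βf k) 1 1 1 (4 * (L : ℝ)) 1)
        (R : ∀ k, Rest (D k)) (bd : ∀ k, (Site 4 → Fin 4 → (Matrix n n ℂ)ˣ) → (D k).Bdry)
        (bg : ∀ k, (Site 4 → Fin 4 → (Matrix n n ℂ)ˣ) → (D k).Cfg),
        (∀ k, ∀ V ∈ {v : Site 4 → Fin 4 → (Matrix n n ℂ)ˣ | IsPeriodicCfg v (N : ℤ) ∧ ∃ w : Site 4 → (Matrix n n ℂ)ˣ,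
            IsUnitarySite w ∧ v = gaugeAct w flatCfg},
          ((D k).toLGData (R k) 1).Sat14 (1 * (4 * (L : ℝ)) * (128 * (L : ℝ))⁻¹) (1 * (128 * (L : ℝ))⁻¹) (bd k V) (bg k V)) ∧
        OneStepCorrectionRate
          {v : Site 4 → Fin 4 → (Matrix n n ℂ)ˣ | IsPeriodicCfg v (N : ℤ) ∧ ∃ w : Site 4 → (Matrix n n ℂ)ˣ,
            IsUnitarySite w ∧ v = gaugeAct w flatCfg}
          (fun k V => ‖(D k).G (bg k V) (Jcur ((D k).bg (bg k V)))‖) 0 (((L : ℝ) ^ 2)⁻¹) := by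
  have hL1 : 1 ≤ L := le_trans (by norm_num) hL
  have hL0 : (0 : ℝ) < (L : ℝ) := by exact_mod_cast (show 0 < L by omega)
  have hL2 : (2 : ℝ) ≤ (L : ℝ) := by exact_mod_cast hL
  obtain ⟨ε, t, ε₁, hε0, hεr, ht0, hε₁0, ht1, ht2, hε1, hε2, hε₁, hε₁t, hε₁t4, -⟩ := shapeRegime_exists hL1 hr
  have hdL : (0 : ℝ) < ((4 : ℕ) : ℝ) * (L : ℝ) := by positivity
  have hdLB₃ : ((4 : ℕ) : ℝ) * (L : ℝ) ≤ 4 * (L : ℝ) := by push_cast; exact le_rfl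
  obtain ⟨D, R, bd, bg, hflat, h14⟩ :=
    resp_family_binders_inhabited (𝔸 := 𝔸) (d := 4) (L := (L : ℝ)) (B₀ := 1) (C₄ := 1) (a₃ := 1) (B₃ := 4 * (L : ℝ))
      (α := 1) (fun k => fun _ : Fin 4 => N * L ^ k) ηf βf zero_le_one zero_le_one hdL hdLB₃ (by positivity)
      {v : Site 4 → Fin 4 → (Matrix n n ℂ)ˣ | IsPeriodicCfg v (N : ℤ) ∧ ∃ w : Site 4 → (Matrix n n ℂ)ˣ,
        IsUnitarySite w ∧ v = gaugeAct w flatCfg}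
  have hLne : (L : ℝ) ≠ 0 := hL0.ne'
  have hθ1 : ((L : ℝ) ^ 2)⁻¹ < 1 := by
    have h1 : (1 : ℝ) < (L : ℝ) ^ 2 := by nlinarith
    exact inv_lt_one_of_one_lt₀ h1
  have hreg1 : 2 * 1 * 1 * (4 * (L : ℝ)) * (128 * (L : ℝ))⁻¹ ≤ 1 / 16 := by
    have h : 2 * 1 * 1 * (4 * (L : ℝ)) * (128 * (L : ℝ))⁻¹ = 1 / 16 * ((L : ℝ) * (L : ℝ)⁻¹) := by ring
    rw [h, mul_inv_cancel₀ hLne, mul_one]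
  have hreg4 : 1 * (4 * (L : ℝ)) * (128 * (L : ℝ))⁻¹ ≤ 1 := by
    have h : 1 * (4 * (L : ℝ)) * (128 * (L : ℝ))⁻¹ = 1 / 32 * ((L : ℝ) * (L : ℝ)⁻¹) := by ring
    rw [h, mul_inv_cancel₀ hLne, mul_one]
    norm_num
  have he₁ : (0 : ℝ) < (128 * (L : ℝ))⁻¹ := by positivity
  have h14' : ∀ k, ∀ V ∈ {v : Site 4 → Fin 4 → (Matrix n n ℂ)ˣ | IsPeriodicCfg v (N : ℤ) ∧ ∃ w : Site 4 → (Matrix n n ℂ)ˣ,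
      IsUnitarySite w ∧ v = gaugeAct w flatCfg},
      ((D k).toLGData (R k) 1).Sat14 (1 * (4 * (L : ℝ)) * (128 * (L : ℝ))⁻¹) (1 * (128 * (L : ℝ))⁻¹) (bd k V) (bg k V) :=
    h14 1 (128 * (L : ℝ))⁻¹ one_pos he₁
  -- OSC with `ρ₁ = 0` at the flat background: the current vanishes (`jcur_one_eq_zero`)
  have hosc : OneStepCorrectionRate
      {v : Site 4 → Fin 4 → (Matrix n n ℂ)ˣ | IsPeriodicCfg v (N : ℤ) ∧ ∃ w : Site 4 → (Matrix n n ℂ)ˣ,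
        IsUnitarySite w ∧ v = gaugeAct w flatCfg}
      (fun k V => ‖(D k).G (bg k V) (Jcur ((D k).bg (bg k V)))‖) 0 (((L : ℝ) ^ 2)⁻¹) := by
    intro k V _
    have hJ : (Jcur ((D k).bg (bg k V)) : B11Eq115Space.NegSize (L : ℝ) (ηf k) (D k).lev₀ 3 𝔸) = 0 := by
      rw [(hflat k V).2]
      exact jcur_one_eq_zero
    show ‖(D k).G (bg k V) (Jcur ((D k).bg (bg k V)))‖ ≤ 0 * (((L : ℝ) ^ 2)⁻¹) ^ k
    rw [hJ, map_zero, norm_zero, zero_mul]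
  exact ⟨ε, t, ε₁, hε0, hεr, ht0, hε₁0, ht1, ht2, hε1, hε2, hε₁, hε₁t, hε₁t4,
    flatStratum_subset_sfClass_zero L N hε₁0.le, flatCfg_mem_flatStratum N,
    leafH3sup_flatStratum hL1 hN hε0.le ht0.le ht0.le, hθ1, ⟨hreg1, by norm_num, by norm_num, hreg4⟩,
    D, R, bd, bg, h14', hosc⟩

end VacuityFour

end

end Summit.QuantumFields.YangMills.BalabanUVNodes.N16
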